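import Summits.AtomisticToContinuum.BoseEinsteinCondensation.Theorems.BECCutLineWeakDisorderTaggedShiftDefs
import Summits.AtomisticToContinuum.BoseEinsteinCondensation.Theorems.BECCutLineWeakDisorderTaggedShiftBlockReduction
import Summits.AtomisticToContinuum.BoseEinsteinCondensation.Theorems.BECCutLineWeakDisorderTaggedShiftCameronMartinRamp
import Summits.AtomisticToContinuum.BoseEinsteinCondensation.Theorems.BECCutLineWeakDisorderTaggedShiftLocalCrowdingHardCore
import Summits.AtomisticToContinuum.BoseEinsteinCondensation.Theorems.BECCutLineWeakDisorderTaggedShiftPhantomFactorisation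
import Summits.AtomisticToContinuum.BoseEinsteinCondensation.Theorems.TwoReplicaTransienceBound.Negative.ConstantAtLeastOne
import HarnessLib
import HarnessLib.Audit

/-!
# Crux `TwoReplicaTransienceBound` (stmt-AtomisticToContinuum-9687) — CHECKED SKELETON of the line
# `tagged-shift-log-harnack`, v4 (lead a1, end of cycle 1)

Vocabulary, stub statements, Goal aliases and the sorry-free composition
(`twoReplica_of_kinetic`, `TwoReplicaTransienceBound_of` = registered bookkeeping stub
`stub_taggedShiftCompose`) are in the LANDED Defs file
`Theorems/BECCutLineWeakDisorderTaggedShiftDefs.lean` (p134027). Landed stubs so far: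

* `stub_flatnessOfBlockParticipation : BlockParticipationBornMoment → KineticScaleFlatnessBeyond`
  (`Theorems/BECCutLineWeakDisorderTaggedShiftBlockReduction.lean`, p134494) — the deterministic block
  reduction `m r̄_K² ≤ Σ_Q m_Q P_Q²`;
* toolbox `stub_cameronMartinRamp` (`…TaggedShiftCameronMartinRamp.lean`, p134520) — Cameron–Martin for a
  ramp drift of the canonical Brownian motion under `preWienerMeasure` (the change-of-measure engine of
  the lever, identity (★) of LeadA1Report §2);
* toolbox `stub_localCrowdingHardCore` (`…TaggedShiftLocalCrowdingHardCore.lean`, p134558) — hard-core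
  crowding, pointwise packing form (valid under any further weight);
* toolbox `stub_taggedCameronMartin` (p135080), `stub_ghostRepresentation` (p135562),
  `stub_phantomFactorisation` (p135703) — the EXACT phantom-window identity (★) of LeadA1Report §2
  (`fkSemigroup_one_eq_lintegral_phantom`: `(e^{-TH}1)(X) = ∫ ℛ · L_ghost · phantomWeight(X + √2τ₀a e₀) dW`,
  every measurable `v`, hard cores and Dirichlet walls included), replacing the card's identity (I);
* toolbox free-gas rows / tools: `stub_coarseSecondMomentFreeGas` (p134863), `stub_freeOneLineTwoTimeDensity`
  (p135070), `stub_crossCutBound` (p135537), `stub_freeTaggedFactorisation` (p135684),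
  `stub_taggedDisplacementFree` (p135825).

OPEN registered stubs (the four `sorry`s below): `stub_localCrowdingBridge` (L; provisional form, see
LeadA1Report §5), `stub_taggedDisplacement` (M/L; provisional form), `stub_shiftHarnack` (THE LEVER, target
`BlockParticipationBornMoment`; STUCK — the card's identity (I) is false under killing, replaced by the exact
phantom-window identity (★); open residual: LeadA1Report §3/§7), `stub_coarseSecondMomentBeyond` (the IR
heart, open-problem, not attacked by this line).

Disproof.lean (cdisprove c1) has no `_false_without_` theorem and no `-- Targets` kill on these stubs;
`Negative/ConstantAtLeastOne` (C ≥ 1) is imported and compatible (composition constant `max (C_UV·C_IR+1) 20`).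
-/

noncomputable section

open MeasureTheory Filter Set Finset
open scoped ENNReal NNReal Topology BigOperators

namespace Summit.AtomisticToContinuum.BoseEinsteinCondensation.Cruxes.TwoReplicaTransienceBound.TaggedShiftLogHarnack

open Literature.MathematicalPhysics.QuantumManyBody.BoseGas
open Summit.AtomisticToContinuum.BoseEinsteinCondensation.Theses.BECCutLineWeakDisorder
open Summit.AtomisticToContinuum.BoseEinsteinCondensation.Cruxes.LandscapeBound.SiblingTelescopingChaining

/-! ### The open stubs (sorried; each a genuine lemma of the line) -/

/-- STUB (OPEN, L; provisional — likely re-typed under the phantom bridge, LeadA1Report §5): local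
crowding exponential moments under the `2T`-bridge, `∃ρ₀ ∀Λ`. -/
theorem stub_localCrowdingBridge : Goal.stub_localCrowdingBridge := by
  sorry

/-- STUB (OPEN, M/L; provisional, idem): Gaussian moments of the tagged displacement over an early
window under the `2T`-bridge. -/
theorem stub_taggedDisplacement : Goal.stub_taggedDisplacement := by
  sorry

/-- STUB (OPEN, STUCK — THE LEVER `stub_shiftHarnack`, target `BlockParticipationBornMoment`): semigroup
split at a horizon `τ₀` + Cameron–Martin ramp of the TAGGED world-line (`stub_cameronMartinRamp`, landed)
+ Jensen under the tilted law, Born average = bridge expectation. The card's identity (I) is FALSE under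
Dirichlet killing / hard cores (LeadA1Report §2, free Dirichlet particle counterexample); the exact
replacement is the phantom-window identity (★) `φ_T(x″+z,Y) = φ̄(x″,Y)·Ē[ℛ_z L(γ^z)]`, under which
`P_Q = ℓ³∫p²/(∫p)²`, `p(z) = Ē[ℛ_z L(γ^z)]`, drops the unknown normaliser; the remaining gap is the
per-apex floor / cage fallback of LeadA1Report §3, §7. -/
theorem stub_shiftHarnack : Goal.stub_shiftHarnack := by
  sorry

/-- STUB (OPEN, open-problem; the IR heart, staffed through the sibling cards' devices): the coarse
second moment beyond the kinetic time. -/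
theorem stub_coarseSecondMomentBeyond : Goal.stub_coarseSecondMomentBeyond := by
  sorry

/-! ### The skeleton -/

/-- The skeleton: the crux from the sorried stubs and the landed block reduction (what the closing
`Theorems/` file will say once every stub is a theorem of the tree). -/
theorem twoReplicaTransienceBound_proof_skeleton :
    Summit.AtomisticToContinuum.BoseEinsteinCondensation.Theses.BECCutLineWeakDisorder.TwoReplicaTransienceBound :=
  TwoReplicaTransienceBound_of stub_localCrowdingBridge stub_taggedDisplacement stub_shiftHarnack
    stub_flatnessOfBlockParticipation stub_coarseSecondMomentBeyond

/-! ### Sanity: landed toolbox stubs and the landed negative lemma are in scope -/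

example := @stub_cameronMartinRamp
example := @stub_localCrowdingHardCore
example := @fkSemigroup_one_eq_lintegral_phantom
example := @fkSemigroup_one_le_phantom
example := @Summit.AtomisticToContinuum.BoseEinsteinCondensation.Theorems.TwoReplicaTransienceBound.Negative.not_twoReplicaTransienceBound_below_one

end Summit.AtomisticToContinuum.BoseEinsteinCondensation.Cruxes.TwoReplicaTransienceBound.TaggedShiftLogHarnack

end
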